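import Summits.CriticalPhenomena.Ising3DConformalLimit.Theses.FKParityRobustness
import Summits.CriticalPhenomena.Ising3DConformalLimit.Theorems.FKParityRobustnessIndependentStrandsJoinShapeDictionary
import Summits.CriticalPhenomena.Ising3DConformalLimit.Theorems.FKParityRobustnessIndependentStrandsJoinLimitDictionary
import Summits.CriticalPhenomena.Ising3DConformalLimit.Theorems.FKParityRobustnessIndependentStrandsJoinLimitUpgrade
import Summits.CriticalPhenomena.Ising3DConformalLimit.Theorems.FKParityRobustnessJoinForcesU4
import HarnessLib

/-!
# The ∃-shape residual of the crux `IndependentStrandsJoin`: clause (iii) + lattice shape transfer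

Helper / composition file of the crux `IndependentStrandsJoin` (item stmt-CriticalPhenomena-14625, route
`FKParityRobustness`, sub-problem `Ising3DConformalLimit`; line `pinch-to-tetra`, revision r5, lead c5-0).

Write `SME` ("shape merging, eventually") for the lattice statement
`∃ c > 0, ∃ a : Fin 4 → ℤ³ injective, ∃ L₁, ∀ L ≥ L₁, U₄^crit(L•a) ≤ −c·⟨σ_{La₀}σ_{La₁}⟩⟨σ_{La₂}σ_{La₃}⟩`
(far merging of the critical lattice Ursell function along all large dilations of SOME injective lattice shape; spelled
out verbatim below, no definition is introduced) and `TME = TetraMergingEventually` for the same along the regular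
tetrahedra `l • tetra`.  The **shape transfer** is the implication `SME → TME`.

* `nonGaussianLimit_iff_shapeMergingEventually` / `…_iff_shapeMergingIO` — **under `LimitExists`,
  `NonGaussianLimit` (item stmt-CriticalPhenomena-0636) ↔ SME ↔ its infinitely-often form** (→ the core
  `exists_shapeMergingEventually_of_hasNontrivialU4` of `…ShapeDictionary.lean`; ← the landed glue `farMergingGivesU4_proof`,
  item stmt-CriticalPhenomena-4471, which is therefore an EQUIVALENCE once a limit exists).
* `tetraMergingEventually_of_independentStrandsJoin` — the crux gives TME outright (`LatticeBoundFromStrands` ∘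
  `StrandsJoinBound`, both closed items), so the shape transfer never over-shoots the crux.
* `independentStrandsJoin_of_limit_nonGaussian_shapeTransfer` — **the r5 composition**
  `LimitExists → NonGaussianLimit → (SME → TME) → IndependentStrandsJoin` (registered sub-goal `stub_shapeResidual`).
* `independentStrandsJoin_iff_nonGaussian_and_shapeTransfer` — **the exact residual**: under `LimitExists`,
  `IndependentStrandsJoin ↔ NonGaussianLimit ∧ (SME → TME)`.  Compared with r4
  (`independentStrandsJoin_iff_nonGaussian_and_tnvM`: `MoebiusLimit → (crux ↔ NonGaussianLimit ∧ TNVᴹ)`) the hypothesis is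
  weakened from item 1344 to `LimitExists` and the residual is a statement about `criticalCorr 3` alone — no limit object,
  no Möbius group: the tetrahedral residual of the crux is NOT a covariance question.
* `shapeTransfer_iff_tnv` — under `LimitExists` the lattice shape transfer is equivalent to the continuum form
  `TNV : ∀ limits, HasNontrivialU4 S → U₄(S)(y_tetra) < 0` of leads c2/c3 (so r5's stub is r4's with the idle hypothesis
  `IsMoebiusCovariant` removed and the limit eliminated).

References: M. Aizenman, Comm. Math. Phys. 86 (1982), §1, Prop. 5.3 [AizenmanCMP1982]; M. Aizenman, H. Duminil-Copin,
Ann. Math. 194 (2021), eq. (3.11) [AizenmanDuminilCopinAnnals2021].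
-/

noncomputable section

open Filter Topology
open Literature.Probability.LatticeModels
open Summit.CriticalPhenomena.Ising3DConformalLimit.Theses.FKParityRobustness
open Summit.CriticalPhenomena.Ising3DConformalLimit.FKParityRobustnessFarMergingGivesU4 (farMergingGivesU4_proof)
open Summit.CriticalPhenomena.Ising3DConformalLimit.FKParityRobustnessJoinForcesU4 (joinForcesU4_proof)
open Summit.CriticalPhenomena.Ising3DConformalLimit.Cruxes.ParityRobustMerging.PlaquetteXorSurgery (tetra)

namespace Summit.CriticalPhenomena.Ising3DConformalLimit.Cruxes.IndependentStrandsJoin.PinchToTetra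

/-! ## `NonGaussianLimit` ⟺ far merging along some lattice shape (modulo `LimitExists`) -/

/-- **Under `LimitExists`: `NonGaussianLimit` (item stmt-CriticalPhenomena-0636) ↔ far merging EVENTUALLY along the
dilations of SOME injective lattice shape.**  (→ `exists_shapeMergingEventually_of_hasNontrivialU4` applied to the
posited limit; ← the landed glue `farMergingGivesU4_proof`, item stmt-CriticalPhenomena-4471.) [folklore] -/
theorem nonGaussianLimit_iff_shapeMergingEventually (hL : LimitExists) :
    NonGaussianLimit ↔
      ∃ c : ℝ, 0 < c ∧ ∃ a : Fin 4 → Site 3, Function.Injective a ∧ ∃ L₁ : ℕ, ∀ L : ℕ, L₁ ≤ L →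
        criticalCorr 3 4 (fun i => (L : ℤ) • a i) -
            (criticalCorr 3 2 ![(L : ℤ) • a 0, (L : ℤ) • a 1] * criticalCorr 3 2 ![(L : ℤ) • a 2, (L : ℤ) • a 3] +
              criticalCorr 3 2 ![(L : ℤ) • a 0, (L : ℤ) • a 2] * criticalCorr 3 2 ![(L : ℤ) • a 1, (L : ℤ) • a 3] +
              criticalCorr 3 2 ![(L : ℤ) • a 0, (L : ℤ) • a 3] * criticalCorr 3 2 ![(L : ℤ) • a 1, (L : ℤ) • a 2]) ≤
          -(c * (criticalCorr 3 2 ![(L : ℤ) • a 0, (L : ℤ) • a 1] * criticalCorr 3 2 ![(L : ℤ) • a 2, (L : ℤ) • a 3])) := by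
  constructor
  · intro h
    obtain ⟨ρ, S, hρ, hlim, hnd⟩ := hL
    exact exists_shapeMergingEventually_of_hasNontrivialU4 hlim hnd (h ρ S hρ hlim hnd)
  · rintro ⟨c, hc, a, ha, L₁, hev⟩ ρ S hρ hlim hnd
    exact farMergingGivesU4_proof ⟨c, hc, a, ha, fun L₀ => ⟨max L₀ L₁, le_max_left _ _, hev _ (le_max_right _ _)⟩⟩
      ρ S hρ hlim hnd

/-- **Under `LimitExists`: `NonGaussianLimit` ↔ far merging along INFINITELY MANY dilations of SOME injective lattice
shape** (the antecedent of `FarMergingGivesU4`, item stmt-CriticalPhenomena-4471 — that glue is an EQUIVALENCE once a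
limit exists; "eventually" and "infinitely often" coincide here). [folklore] -/
theorem nonGaussianLimit_iff_shapeMergingIO (hL : LimitExists) :
    NonGaussianLimit ↔
      ∃ c : ℝ, 0 < c ∧ ∃ a : Fin 4 → Site 3, Function.Injective a ∧ ∀ L₀ : ℕ, ∃ L : ℕ, L₀ ≤ L ∧
        criticalCorr 3 4 (fun i => (L : ℤ) • a i) -
            (criticalCorr 3 2 ![(L : ℤ) • a 0, (L : ℤ) • a 1] * criticalCorr 3 2 ![(L : ℤ) • a 2, (L : ℤ) • a 3] +
              criticalCorr 3 2 ![(L : ℤ) • a 0, (L : ℤ) • a 2] * criticalCorr 3 2 ![(L : ℤ) • a 1, (L : ℤ) • a 3] +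
              criticalCorr 3 2 ![(L : ℤ) • a 0, (L : ℤ) • a 3] * criticalCorr 3 2 ![(L : ℤ) • a 1, (L : ℤ) • a 2]) ≤
          -(c * (criticalCorr 3 2 ![(L : ℤ) • a 0, (L : ℤ) • a 1] * criticalCorr 3 2 ![(L : ℤ) • a 2, (L : ℤ) • a 3])) := by
  constructor
  · intro h
    obtain ⟨c, hc, a, ha, L₁, hev⟩ := (nonGaussianLimit_iff_shapeMergingEventually hL).1 h
    exact ⟨c, hc, a, ha, fun L₀ => ⟨max L₀ L₁, le_max_left _ _, hev _ (le_max_right _ _)⟩⟩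
  · rintro h ρ S hρ hlim hnd
    exact farMergingGivesU4_proof h ρ S hρ hlim hnd

/-! ## The crux gives tetrahedral merging at every scale -/

/-- **`IndependentStrandsJoin → TetraMergingEventually`** (indeed from scale `1` on): the crux's uniform constant passes
to the infinite-volume critical Ursell function at every dilated tetrahedron (closed items `StrandsJoinBound`,
stmt-CriticalPhenomena-14647, and `LatticeBoundFromStrands`, stmt-CriticalPhenomena-14648).  So the conclusion of the
shape transfer is implied by the crux outright. [folklore] -/
theorem tetraMergingEventually_of_independentStrandsJoin (h : IndependentStrandsJoin) : TetraMergingEventually := by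
  obtain ⟨c, hc, hall⟩ :=
    Summit.CriticalPhenomena.Ising3DConformalLimit.FKParityRobustnessLatticeBoundFromStrands.latticeBoundFromStrands_proof
      h Summit.CriticalPhenomena.Ising3DConformalLimit.FKParityRobustnessStrandsJoinBound.strandsJoinBound_proof
  refine ⟨c, hc, 1, fun l hl => ?_⟩
  have := hall l hl
  simpa [U4crit, GGcrit, tetra] using this

/-! ## The r5 composition and the exact residual -/

/-- **`LimitExists → NonGaussianLimit → (SME → TME) → IndependentStrandsJoin`** (the r5 composition of line
`pinch-to-tetra`): the posited limit `S` has `U₄(S) ≢ 0` by clause (iii); the ∃-shape dictionary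
(`exists_shapeMergingEventually_of_hasNontrivialU4`) turns this into far merging along some lattice shape; the shape
transfer moves it to the regular tetrahedra; the landed limit upgrade (`stub_limitUpgrade` with `stub_perScale`) returns
the lattice crux BY NAME. [folklore] -/
theorem independentStrandsJoin_of_limit_nonGaussian_shapeTransfer (hL : LimitExists) (hNG : NonGaussianLimit)
    (hST : (∃ c : ℝ, 0 < c ∧ ∃ a : Fin 4 → Site 3, Function.Injective a ∧ ∃ L₁ : ℕ, ∀ L : ℕ, L₁ ≤ L →
        criticalCorr 3 4 (fun i => (L : ℤ) • a i) -
            (criticalCorr 3 2 ![(L : ℤ) • a 0, (L : ℤ) • a 1] * criticalCorr 3 2 ![(L : ℤ) • a 2, (L : ℤ) • a 3] +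
              criticalCorr 3 2 ![(L : ℤ) • a 0, (L : ℤ) • a 2] * criticalCorr 3 2 ![(L : ℤ) • a 1, (L : ℤ) • a 3] +
              criticalCorr 3 2 ![(L : ℤ) • a 0, (L : ℤ) • a 3] * criticalCorr 3 2 ![(L : ℤ) • a 1, (L : ℤ) • a 2]) ≤
          -(c * (criticalCorr 3 2 ![(L : ℤ) • a 0, (L : ℤ) • a 1] * criticalCorr 3 2 ![(L : ℤ) • a 2, (L : ℤ) • a 3]))) →
      TetraMergingEventually) :
    IndependentStrandsJoin := by
  have hSME := (nonGaussianLimit_iff_shapeMergingEventually hL).1 hNG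
  exact Summit.CriticalPhenomena.Ising3DConformalLimit.Theorems.stub_limitUpgrade hL
    (tetraMergingIO_of_eventually (hST hSME)) Summit.CriticalPhenomena.Ising3DConformalLimit.Theorems.stub_perScale

/-- **The exact residual (r5): under `LimitExists`, `IndependentStrandsJoin ↔ NonGaussianLimit ∧ (SME → TME)`.**
(→: the closed bridge `joinForcesU4_proof` and `tetraMergingEventually_of_independentStrandsJoin`;
←: `independentStrandsJoin_of_limit_nonGaussian_shapeTransfer`.)  Modulo the existence of a non-degenerate limit the
rank-2 crux is clause (iii) [item stmt-CriticalPhenomena-0636] AND a purely lattice shape transfer. [folklore] -/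
theorem independentStrandsJoin_iff_nonGaussian_and_shapeTransfer (hL : LimitExists) :
    IndependentStrandsJoin ↔ (NonGaussianLimit ∧
      ((∃ c : ℝ, 0 < c ∧ ∃ a : Fin 4 → Site 3, Function.Injective a ∧ ∃ L₁ : ℕ, ∀ L : ℕ, L₁ ≤ L →
        criticalCorr 3 4 (fun i => (L : ℤ) • a i) -
            (criticalCorr 3 2 ![(L : ℤ) • a 0, (L : ℤ) • a 1] * criticalCorr 3 2 ![(L : ℤ) • a 2, (L : ℤ) • a 3] +
              criticalCorr 3 2 ![(L : ℤ) • a 0, (L : ℤ) • a 2] * criticalCorr 3 2 ![(L : ℤ) • a 1, (L : ℤ) • a 3] +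
              criticalCorr 3 2 ![(L : ℤ) • a 0, (L : ℤ) • a 3] * criticalCorr 3 2 ![(L : ℤ) • a 1, (L : ℤ) • a 2]) ≤
          -(c * (criticalCorr 3 2 ![(L : ℤ) • a 0, (L : ℤ) • a 1] * criticalCorr 3 2 ![(L : ℤ) • a 2, (L : ℤ) • a 3]))) →
      TetraMergingEventually)) :=
  ⟨fun h => ⟨joinForcesU4_proof h, fun _ => tetraMergingEventually_of_independentStrandsJoin h⟩,
    fun h => independentStrandsJoin_of_limit_nonGaussian_shapeTransfer hL h.1 h.2⟩

/-- **`TME` forces `U₄(S)(y_tetra) < 0` for every non-degenerate limit** (through the landed dictionary: TME → TetraMergingIO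
→ crux by the limit upgrade at the limit itself → `U₄(S)(y_tetra) < 0`). [folklore] -/
theorem limitU4_tetra_neg_of_tetraMergingEventually {ρ : ℝ → ℝ} {S : CorrFamily 3}
    (hρ : ∀ δ ∈ Set.Ioc (0:ℝ) 1, 0 < ρ δ) (hlim : HasPointwiseScalingLimit (criticalCorr 3) ρ S)
    (hnd : IsNondegenerateTwoPoint S) (h : TetraMergingEventually) : limitConnectedFour S yTetra < 0 :=
  (independentStrandsJoin_iff_limitU4_tetra_neg hρ hlim hnd).1
    (Summit.CriticalPhenomena.Ising3DConformalLimit.Theorems.stub_limitUpgrade ⟨ρ, S, hρ, hlim, hnd⟩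
      (tetraMergingIO_of_eventually h) Summit.CriticalPhenomena.Ising3DConformalLimit.Theorems.stub_perScale)

/-- **Under `LimitExists` the lattice shape transfer `SME → TME` is EQUIVALENT to the continuum tetrahedral
non-vanishing `TNV : ∀ non-degenerate limits, HasNontrivialU4 S → U₄(S)(y_tetra) < 0`** (r5's stub is r4's with the idle
hypothesis `IsMoebiusCovariant` dropped and the limit object eliminated).  (→: given the transfer and a limit with
`HasNontrivialU4 S`, the ∃-shape dictionary gives SME, the transfer gives TME, and
`limitU4_tetra_neg_of_tetraMergingEventually` the sign at `y_tetra`; ←: given TNV and SME, SME is clause (iii) for the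
posited limit (`nonGaussianLimit_iff_shapeMergingEventually`), TNV gives `U₄(S)(y_tetra) < 0`, and the landed
`tetraMergingEventually_of_limitU4_tetra_neg` gives TME.) [folklore] -/
theorem shapeTransfer_iff_tnv (hL : LimitExists) :
    ((∃ c : ℝ, 0 < c ∧ ∃ a : Fin 4 → Site 3, Function.Injective a ∧ ∃ L₁ : ℕ, ∀ L : ℕ, L₁ ≤ L →
        criticalCorr 3 4 (fun i => (L : ℤ) • a i) -
            (criticalCorr 3 2 ![(L : ℤ) • a 0, (L : ℤ) • a 1] * criticalCorr 3 2 ![(L : ℤ) • a 2, (L : ℤ) • a 3] +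
              criticalCorr 3 2 ![(L : ℤ) • a 0, (L : ℤ) • a 2] * criticalCorr 3 2 ![(L : ℤ) • a 1, (L : ℤ) • a 3] +
              criticalCorr 3 2 ![(L : ℤ) • a 0, (L : ℤ) • a 3] * criticalCorr 3 2 ![(L : ℤ) • a 1, (L : ℤ) • a 2]) ≤
          -(c * (criticalCorr 3 2 ![(L : ℤ) • a 0, (L : ℤ) • a 1] * criticalCorr 3 2 ![(L : ℤ) • a 2, (L : ℤ) • a 3]))) →
      TetraMergingEventually) ↔
    ∀ (ρ : ℝ → ℝ) (S : CorrFamily 3), (∀ δ ∈ Set.Ioc (0:ℝ) 1, 0 < ρ δ) →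
      HasPointwiseScalingLimit (criticalCorr 3) ρ S → IsNondegenerateTwoPoint S → HasNontrivialU4 S →
      limitConnectedFour S yTetra < 0 := by
  constructor
  · intro hST ρ S hρ hlim hnd hU
    exact limitU4_tetra_neg_of_tetraMergingEventually hρ hlim hnd
      (hST (exists_shapeMergingEventually_of_hasNontrivialU4 hlim hnd hU))
  · intro hTNV hSME
    obtain ⟨ρ, S, hρ, hlim, hnd⟩ := hL
    have hU : HasNontrivialU4 S :=
      (nonGaussianLimit_iff_shapeMergingEventually ⟨ρ, S, hρ, hlim, hnd⟩).2 hSME ρ S hρ hlim hnd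
    exact tetraMergingEventually_of_limitU4_tetra_neg hρ hlim hnd (hTNV ρ S hρ hlim hnd hU)

end Summit.CriticalPhenomena.Ising3DConformalLimit.Cruxes.IndependentStrandsJoin.PinchToTetra

/-! ## The registered sub-goal `stub_shapeResidual` -/

namespace Summit.CriticalPhenomena.Ising3DConformalLimit.Theorems

open Summit.CriticalPhenomena.Ising3DConformalLimit.Cruxes.IndependentStrandsJoin.PinchToTetra

/-- **Registered sub-goal `stub_shapeResidual` of the crux `IndependentStrandsJoin`** (stmt-CriticalPhenomena-14625, line
`pinch-to-tetra` r5): existence of a non-degenerate pointwise limit, clause (iii) (`NonGaussianLimit`, item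
stmt-CriticalPhenomena-0636) and the lattice shape transfer `SME → TetraMergingEventually` imply the crux BY NAME
(`PinchToTetra.independentStrandsJoin_of_limit_nonGaussian_shapeTransfer`). -/
theorem stub_shapeResidual :
    LimitExists → NonGaussianLimit →
      ((∃ c : ℝ, 0 < c ∧ ∃ a : Fin 4 → Site 3, Function.Injective a ∧ ∃ L₁ : ℕ, ∀ L : ℕ, L₁ ≤ L →
        criticalCorr 3 4 (fun i => (L : ℤ) • a i) -
            (criticalCorr 3 2 ![(L : ℤ) • a 0, (L : ℤ) • a 1] * criticalCorr 3 2 ![(L : ℤ) • a 2, (L : ℤ) • a 3] +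
              criticalCorr 3 2 ![(L : ℤ) • a 0, (L : ℤ) • a 2] * criticalCorr 3 2 ![(L : ℤ) • a 1, (L : ℤ) • a 3] +
              criticalCorr 3 2 ![(L : ℤ) • a 0, (L : ℤ) • a 3] * criticalCorr 3 2 ![(L : ℤ) • a 1, (L : ℤ) • a 2]) ≤
          -(c * (criticalCorr 3 2 ![(L : ℤ) • a 0, (L : ℤ) • a 1] * criticalCorr 3 2 ![(L : ℤ) • a 2, (L : ℤ) • a 3]))) →
        TetraMergingEventually) →
      IndependentStrandsJoin :=
  independentStrandsJoin_of_limit_nonGaussian_shapeTransfer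

end Summit.CriticalPhenomena.Ising3DConformalLimit.Theorems

end
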